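import Summits.AtomisticToContinuum.FouriersLaw.Theorems.BondHeatUncertaintyDefs
import Literature.MathematicalPhysics.KineticTheory.LangevinChainEnergyIdentity
import Summits.AtomisticToContinuum.FouriersLaw.Theorems.BondHeatUncertaintySubdiffusiveBondHeatBathBondReductionVariance
import Summits.AtomisticToContinuum.FouriersLaw.Theorems.BondHeatUncertaintySubdiffusiveBondHeatBathBondReductionCorrelations

/-!
# Helper 9 for stub `stub_bondHeatVarianceContinuity` (crux ★ `LinearResponseFTUR`, stmt-AtomisticToContinuum-9122):
# the bond-heat variance under the flux law, as a kernel-level quantity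

Support file for line `lebesgue-flip-duality`, stub K6b. For the pinned chain (`ω₂ > 0`, `lam, β, γ ≥ 0`),
an initial law `μ` (probability) invariant under the constructed kernels at temperatures `(a, b)` with
`j_b² ∈ L¹(μ)`, and `t ≥ 0`: the bond-heat coordinate `Q_t = ∫₀ᵗ j_b(z_s) ds` is square integrable under the
flux law `fluxLaw P N i0 iN ib a b t μ` and
`Var(Q_t) = 2∫₀ᵗ (t - r) ∫ j_b · (P_r j_b) dμ dr - (t · μ(j_b))²` (`variance_bondHeat_fluxLaw`): the flux law is
the image of `μ ⊗ W` (variance of an image law = variance of the composed observable), the second moment is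
the tree's `SubdiffusiveBondHeat.pinnedChain_integral_sq_intervalIntegral_of_invariant`, the mean is
`t · μ(j_b)` by Fubini and the one-time law. Nothing here closes an item.
-/

noncomputable section

namespace Summit.AtomisticToContinuum.FouriersLaw.Theorems.LinearResponseFTUR

open MeasureTheory ProbabilityTheory Filter Topology Set
open scoped NNReal ENNReal Topology
open Literature.MathematicalPhysics.KineticTheory.HeatConduction Literature.Probability.Process OscillatorChain
open Summit.AtomisticToContinuum.FouriersLaw.Theorems.BondHeatUncertainty
open Summit.AtomisticToContinuum.FouriersLaw.Theorems.SubdiffusiveBondHeat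

section Flux

variable {ω₂ lam β γ : ℝ} (hω : 0 < ω₂) (hl : 0 ≤ lam) (hβ : 0 ≤ β) (hγ : 0 ≤ γ) (N : ℕ) (a b : ℝ)
include hω hl hβ hγ

/-- A time integral of a continuous observable along the constructed flow is jointly measurable in the
start and the driving pair. [folklore] -/
private theorem measurable_timeIntegral {f : PhaseSpace N → ℝ} (hf : Continuous f) (t : ℝ) :
    Measurable fun p : PhaseSpace N × WienerPair =>
      ∫ s in (0:ℝ)..t, f ((pinnedChain ω₂ lam β γ).solMap N a b s p.1 (pairPath p.2)) := by
  refine measurable_intervalIntegral_of_continuous_of_measurable (fun p => ?_) (fun s => ?_) t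
  · exact hf.comp (pinnedChain_continuous_solMap hω hl hβ hγ N a b p.1 (pairPath p.2))
  · exact hf.measurable.comp (pinnedChain_measurable_solMap_pairPath hω hl hβ hγ N a b s)

/-- The raw observable of the forward path is a measurable function of `(z, w)`. [folklore] -/
private theorem measurable_rawObs_fwdPath (i0 iN ib : Fin N) (t : ℝ) :
    Measurable fun zw : PhaseSpace N × WienerPair =>
      rawObs (pinnedChain ω₂ lam β γ) N i0 iN ib t zw.1 (fwdPath (pinnedChain ω₂ lam β γ) N a b zw.1 zw.2) := by
  have hH : ContDiff ℝ 1 ((pinnedChain ω₂ lam β γ).hamiltonian N) :=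
    pinnedChain_contDiff_hamiltonian ω₂ lam β γ N
  have hW : ∀ i : Fin N, Measurable fun zw : PhaseSpace N × WienerPair =>
      workIntegral (pinnedChain ω₂ lam β γ) N i t (fwdPath (pinnedChain ω₂ lam β γ) N a b zw.1 zw.2) := by
    intro i
    have hc : Continuous fun x : PhaseSpace N => x.2 i * partialQ i ((pinnedChain ω₂ lam β γ).hamiltonian N) x :=
      ((continuous_apply i).comp continuous_snd).mul
        ((pinnedChain ω₂ lam β γ).continuous_partialQ_hamiltonian hH i)
    exact measurable_timeIntegral hω hl hβ hγ N a b hc t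
  have hB : Measurable fun zw : PhaseSpace N × WienerPair =>
      bondHeat (pinnedChain ω₂ lam β γ) N ib t (fwdPath (pinnedChain ω₂ lam β γ) N a b zw.1 zw.2) :=
    measurable_timeIntegral hω hl hβ hγ N a b (pinnedChain_continuous_bondCurrent ω₂ lam β γ N ib) t
  have hX : Measurable fun zw : PhaseSpace N × WienerPair => fwdPath (pinnedChain ω₂ lam β γ) N a b zw.1 zw.2 t :=
    pinnedChain_measurable_solMap_pairPath hω hl hβ hγ N a b t
  exact measurable_fst.prodMk (hX.prodMk ((hW i0).prodMk ((hW iN).prodMk hB)))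

/-- **The bond-heat variance under the flux law is a kernel-level quantity**: for a probability law `μ`
invariant under the constructed kernels at `(a, b)` with `j_b² ∈ L¹(μ)` and `t ≥ 0`, the bond-heat coordinate
is square integrable under `fluxLaw P N i0 iN ib a b t μ` and
`Var(Q_t) = 2∫₀ᵗ (t - r) ∫ j_b·(P_r j_b) dμ dr - (t μ(j_b))²`. [folklore] -/
private theorem variance_bondHeat_fluxLaw (i0 iN ib : Fin N) (μ : Measure (PhaseSpace N)) [IsProbabilityMeasure μ]
    (hinv : ∀ s : ℝ≥0, μ.bind ((pinnedChain ω₂ lam β γ).transitionKernel N a b s) = μ)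
    (hj2 : Integrable (fun y => (pinnedChain ω₂ lam β γ).bondCurrent N ib y ^ 2) μ) {t : ℝ} (ht : 0 ≤ t) :
    MemLp (fun p : Obs N => p.2.2.2.2) 2 (fluxLaw (pinnedChain ω₂ lam β γ) N i0 iN ib a b t μ) ∧
    variance (fun p : Obs N => p.2.2.2.2) (fluxLaw (pinnedChain ω₂ lam β γ) N i0 iN ib a b t μ) =
      2 * (∫ r in (0:ℝ)..t, (t - r) * ∫ y, (pinnedChain ω₂ lam β γ).bondCurrent N ib y *
          (∫ y', (pinnedChain ω₂ lam β γ).bondCurrent N ib y'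
            ∂((pinnedChain ω₂ lam β γ).transitionKernel N a b r.toNNReal y)) ∂μ) -
        (t * ∫ y, (pinnedChain ω₂ lam β γ).bondCurrent N ib y ∂μ) ^ 2 := by
  set P := pinnedChain ω₂ lam β γ with hP
  set j := P.bondCurrent N ib with hj
  have hjc : Continuous j := pinnedChain_continuous_bondCurrent ω₂ lam β γ N ib
  have hjm : Measurable j := hjc.measurable
  set Φ : PhaseSpace N × WienerPair → Obs N := fun zw => rawObs P N i0 iN ib t zw.1 (fwdPath P N a b zw.1 zw.2)
    with hΦ
  have hΦm : Measurable Φ := measurable_rawObs_fwdPath hω hl hβ hγ N a b i0 iN ib t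
  set Q : PhaseSpace N × WienerPair → ℝ := fun p => ∫ s in (0:ℝ)..t, j (P.solMap N a b s p.1 (pairPath p.2)) with hQ
  have hQm : Measurable Q := measurable_timeIntegral hω hl hβ hγ N a b hjc t
  have hcomp : (fun p : Obs N => p.2.2.2.2) ∘ Φ = Q := rfl
  have hlaw : fluxLaw P N i0 iN ib a b t μ = (μ.prod wienerPair).map Φ := rfl
  have hcoord : AEStronglyMeasurable (fun p : Obs N => p.2.2.2.2) ((μ.prod wienerPair).map Φ) :=
    (measurable_snd.snd.snd.snd).aestronglyMeasurable
  -- square integrability of `Q`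
  have hQQ := pinnedChain_integrable_intervalIntegral_mul_of_invariant hω hl hβ hγ N a b μ hinv hjm hjm hj2 hj2 ht
  have hQ2 : Integrable (fun p => Q p ^ 2) (μ.prod wienerPair) :=
    hQQ.congr (Eventually.of_forall fun p => by simp only [hQ]; ring)
  have hmem : MemLp Q 2 (μ.prod wienerPair) := (memLp_two_iff_integrable_sq hQm.aestronglyMeasurable).2 hQ2
  refine ⟨?_, ?_⟩
  · rw [hlaw, memLp_map_measure_iff hcoord hΦm.aemeasurable, hcomp]
    exact hmem
  rw [hlaw, variance_map hcoord.aemeasurable hΦm.aemeasurable, hcomp, variance_eq_sub hmem]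
  -- the second moment
  have hE2 : ∫ p, (Q ^ 2) p ∂(μ.prod wienerPair) = 2 * ∫ r in (0:ℝ)..t, (t - r) *
      ∫ y, j y * (∫ y', j y' ∂(P.transitionKernel N a b r.toNNReal y)) ∂μ := by
    have h := pinnedChain_integral_sq_intervalIntegral_of_invariant hω hl hβ hγ N a b μ hinv hjm hj2 ht
    simpa only [Pi.pow_apply] using h
  -- the mean: Fubini and the one-time law
  have honeTime : ∀ s : ℝ, ∫ p, j (P.solMap N a b s p.1 (pairPath p.2)) ∂(μ.prod wienerPair) = ∫ y, j y ∂μ := by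
    intro s
    have hm := pinnedChain_measurable_solMap_pairPath hω hl hβ hγ N a b ((s.toNNReal : ℝ≥0) : ℝ)
    have hlaw' := pinnedChain_map_solMap_of_invariant hω hl hβ hγ N a b μ _ (hinv (s.toNNReal))
    calc ∫ p, j (P.solMap N a b s p.1 (pairPath p.2)) ∂(μ.prod wienerPair)
        = ∫ p, j (P.solMap N a b ((s.toNNReal : ℝ≥0) : ℝ) p.1 (pairPath p.2)) ∂(μ.prod wienerPair) := by
          refine integral_congr_ae (Eventually.of_forall fun p => ?_)
          simp only
          rw [pinnedChain_solMap_eq_solMap_toNNReal N a b s]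
      _ = ∫ y, j y ∂((μ.prod wienerPair).map
            (fun p => P.solMap N a b ((s.toNNReal : ℝ≥0) : ℝ) p.1 (pairPath p.2))) :=
          (integral_map hm.aemeasurable hjc.aestronglyMeasurable).symm
      _ = ∫ y, j y ∂μ := by rw [hlaw']
  have hE1 : ∫ p, Q p ∂(μ.prod wienerPair) = t * ∫ y, j y ∂μ := by
    have hG := pinnedChain_integrable_uncurry_pointTime_of_invariant hω hl hβ hγ N a b μ hinv hjm
      (measurable_const (a := (1:ℝ))) hj2 (integrable_const _) 0 t
    have hG' : Integrable (Function.uncurry fun (p : PhaseSpace N × WienerPair) (s : ℝ) =>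
        j (P.solMap N a b s p.1 (pairPath p.2))) ((μ.prod wienerPair).prod (volume.restrict (Ioc 0 t))) := by
      refine hG.congr (Eventually.of_forall fun q => ?_)
      show (1 : ℝ) * j (P.solMap N a b q.2 q.1.1 (pairPath q.1.2)) = j (P.solMap N a b q.2 q.1.1 (pairPath q.1.2))
      exact one_mul _
    calc ∫ p, Q p ∂(μ.prod wienerPair)
        = ∫ p, (∫ s in Ioc 0 t, j (P.solMap N a b s p.1 (pairPath p.2))) ∂(μ.prod wienerPair) := by
          refine integral_congr_ae (Eventually.of_forall fun p => ?_)
          exact intervalIntegral.integral_of_le ht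
      _ = ∫ s in Ioc 0 t, (∫ p, j (P.solMap N a b s p.1 (pairPath p.2)) ∂(μ.prod wienerPair)) :=
          integral_integral_swap hG'
      _ = ∫ s in Ioc 0 t, (∫ y, j y ∂μ) := integral_congr_ae (Eventually.of_forall fun s => honeTime s)
      _ = t * ∫ y, j y ∂μ := by
          rw [setIntegral_const, smul_eq_mul, Measure.real, Real.volume_Ioc, ENNReal.toReal_ofReal (by linarith),
            sub_zero]
  have hE1' : ∫ p, Q p ∂(μ.prod wienerPair) = (μ.prod wienerPair)[Q] := rfl
  rw [hE2, hE1]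

end Flux

/-- **The bond-heat variance under the flux law, kernel form** (registered sub-goal of
`stub_bondHeatVarianceContinuity`; closed form of `variance_bondHeat_fluxLaw`): for the pinned chain
(`ω₂ > 0`, `lam, β, γ ≥ 0`), a probability law `μ` invariant under the constructed kernels at `(a, b)` with
`j_b² ∈ L¹(μ)`, and `t ≥ 0`: the bond-heat coordinate is square integrable under the flux law and
`Var(Q_t) = 2∫₀ᵗ (t - r) ∫ j_b·(P_r j_b) dμ dr - (t μ(j_b))²`. [folklore] -/
theorem varianceBondHeatFluxLaw :
    ∀ (ω₂ lam β γ : ℝ), 0 < ω₂ → 0 ≤ lam → 0 ≤ β → 0 ≤ γ → ∀ (N : ℕ) (a b : ℝ) (i0 iN ib : Fin N)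
      (μ : Measure (PhaseSpace N)), IsProbabilityMeasure μ →
      (∀ s : ℝ≥0, μ.bind ((pinnedChain ω₂ lam β γ).transitionKernel N a b s) = μ) →
      Integrable (fun y => (pinnedChain ω₂ lam β γ).bondCurrent N ib y ^ 2) μ →
      ∀ t : ℝ, 0 ≤ t →
      MemLp (fun p : Obs N => p.2.2.2.2) 2 (fluxLaw (pinnedChain ω₂ lam β γ) N i0 iN ib a b t μ) ∧
      variance (fun p : Obs N => p.2.2.2.2) (fluxLaw (pinnedChain ω₂ lam β γ) N i0 iN ib a b t μ) =
        2 * (∫ r in (0:ℝ)..t, (t - r) * ∫ y, (pinnedChain ω₂ lam β γ).bondCurrent N ib y *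
            (∫ y', (pinnedChain ω₂ lam β γ).bondCurrent N ib y'
              ∂((pinnedChain ω₂ lam β γ).transitionKernel N a b r.toNNReal y)) ∂μ) -
          (t * ∫ y, (pinnedChain ω₂ lam β γ).bondCurrent N ib y ∂μ) ^ 2 := by
  intro ω₂ lam β γ hω hl hβ hγ N a b i0 iN ib μ hμ hinv hj2 t ht
  exact variance_bondHeat_fluxLaw hω hl hβ hγ N a b i0 iN ib μ hinv hj2 ht

end Summit.AtomisticToContinuum.FouriersLaw.Theorems.LinearResponseFTUR

end
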